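import Summits.Ventures.PercRepro.RankLevelSetMinorPairProfile

/-! # RankLevelSetMinorPairInduction — THE RANK BOOKKEEPING OF THE ELEMENT RECURSION: THE CUMULATIVE SKEW ON EVERY
PAIR OF COMPLEMENTARY MINORS WITH `r₁ ≤ r₂` FOLLOWS FROM ITS EQUAL-RANK SLICE (M₀), HENCE (CX*) AND THE WHOLE
LADDER (PC) ⟹ (★★) ⟹ Mono, (CD) DO (night-1 g29; dossier §41.5)

For disjoint independent `Y₁, Y₂ ⊆ E` the ranks of the two complementary minors are `r₁ = r(E ∖ Y₂) − #Y₁`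
(`M / Y₁ ∖ Y₂`) and `r₂ = r(E ∖ Y₁) − #Y₂` (`M / Y₂ ∖ Y₁`), so `r₁ + d = r₂` reads, without subtraction,
`r(E ∖ Y₂) + #Y₂ + d = r(E ∖ Y₁) + #Y₁` (`mpRk`, the ℕ-valued rank of a finite matroid). THE NATURAL SKEW
PARAMETER is `R = m − 1 − d` (`m = #(E ∖ (Y₁ ∪ Y₂))`): «skewed right about the support centre minus 1/2».
* **(M₀)** = `MinorPairEqualRankSkew M` (a `Prop`, NOT asserted): `MinorPairSkew M Y₁ Y₂ (m − 1)` for every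
  equal-rank pair (`d = 0`). Its `(∅, ∅)` case is `D_i ≤ D_j` for `i < j`, `i + j ≤ n − 1` — the monotonicity of the
  bi-independent profile below the middle, the consequence of the named Lorentzian fact. Census (night-1 g29, own
  exact code): every matroid on ≤ 8 elements, all pairs with `#Y_i ≤ 3`: 0 failures / 2,192,712 comparisons at `n = 8`.
* **`minorPairSkew_of_equalRankSkew`** — THE INDUCTION (dossier §41.5): `(M₀)` for `M` implies
  `MinorPairSkew M Y₁ Y₂ (m − 1 − d)` for EVERY pair with `r(E ∖ Y₂) + #Y₂ + d = r(E ∖ Y₁) + #Y₁`, by induction on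
  `m` through the exact recursion `minorPairSkew_of_split` at an element `w ∈ E ∖ (Y₁ ∪ Y₂)` that is NOT a coloop of
  `M ↾ (E ∖ Y₂)` (`w ∈ cl((E ∖ Y₂) ∖ {w})`; one exists as soon as `d ≥ 1`: if every such `w` were a coloop,
  `E ∖ Y₂` would be independent and `d = 0`). The through-`w` child `(Y₁ + w, Y₂)` has `d₁ ∈ {d, d + 1}` and lives at
  `m − 1`, so its natural parameter is `≥ R − 2`; the avoid-`w` child `(Y₁, Y₂ + w)` has `d₂ = d − 1` (the choice of
  `w`), so its parameter is exactly `R`. Children with a dependent `Y_i + w` have a zero profile.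
* **`biContainSkew_of_equalRankSkew`**: `(M₀)` for `M` implies (CX*) = `BiContainSkew M` (the `(X, ∅)` slices have
  `d ≤ #X`); **`biIndepPerElem_of_equalRankSkew`**, **`indepCD_of_equalRankSkew`**: `(M₀)` on every minor of `M`
  implies (★★) = `BiIndepPerElem M` and (CD) = `IndepCD M` through the landed ladder.
THE RESIDUE of the element induction is therefore (M₀) alone — «Mono for the pairs of complementary minors of equal
rank» — whose `(∅,∅)` case is the Lorentzian consequence; the recursion stops there because the avoid-`w` child of an
equal-rank pair has `r₁ = r₂ + 1`, and for such pairs the statement «skewed right about `m/2`» is FALSE on crossing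
pairs (dossier §41.4 (d), witness `M(K_{2,3}) ⊕ U_{1,2}`). Nothing here asserts (M₀); every declaration has a
docstring; imports: the cell's own modules and Mathlib only. Axioms: standard. -/

namespace PercRepro

open Set Matroid

variable {α : Type} (M : Matroid α) [M.Finite]

/-! ## The ℕ-valued rank of a finite matroid -/

omit [M.Finite] in
/-- The ℕ-valued rank `(M.eRk X).toNat` of a set (finite matroids only). -/
noncomputable def mpRk (X : Set α) : ℕ := (M.eRk X).toNat

/-- In a finite matroid `mpRk` casts back to `eRk`. -/
lemma coe_mpRk (X : Set α) : ((mpRk M X : ℕ) : ℕ∞) = M.eRk X := by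
  unfold mpRk
  exact ENat.coe_toNat_eq_self.mpr (M.eRk_ne_top_iff.mpr (M.isRkFinite_set X))

/-- `mpRk` is monotone. -/
lemma mpRk_mono {X Y : Set α} (h : X ⊆ Y) : mpRk M X ≤ mpRk M Y := by
  have := M.eRk_mono h
  rw [← coe_mpRk M X, ← coe_mpRk M Y] at this
  exact_mod_cast this

/-- `mpRk X ≤ #X` for a finite `X`. -/
lemma mpRk_le_ncard {X : Set α} (hX : X.Finite) : mpRk M X ≤ X.ncard := by
  have := M.eRk_le_encard X
  rw [← coe_mpRk M X, ← hX.cast_ncard_eq] at this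
  exact_mod_cast this

/-- The rank of an independent set is its size. -/
lemma mpRk_indep {I : Set α} (hI : M.Indep I) : mpRk M I = I.ncard := by
  have h := hI.eRk_eq_encard
  rw [← coe_mpRk M I, ← (M.ground_finite.subset hI.subset_ground).cast_ncard_eq] at h
  exact_mod_cast h

/-- Inserting an element raises the rank by at most one. -/
lemma mpRk_insert_le (e : α) (X : Set α) : mpRk M (insert e X) ≤ mpRk M X + 1 := by
  have := M.eRk_insert_le_add_one e X
  rw [← coe_mpRk M (insert e X), ← coe_mpRk M X] at this
  exact_mod_cast this

/-- If `w` lies in the closure of `X ∖ {w}` (`w` is not a coloop of `M ↾ X`), removing it keeps the rank. -/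
lemma mpRk_sdiff_singleton_of_mem_closure {X : Set α} (hX : X ⊆ M.E) {w : α}
    (hw : w ∈ M.closure (X \ {w})) : mpRk M (X \ {w}) = mpRk M X := by
  apply le_antisymm (mpRk_mono M Set.sdiff_subset)
  have h1 : X ⊆ M.closure (X \ {w}) := by
    intro x hx
    rcases eq_or_ne x w with rfl | hxw
    · exact hw
    · exact M.subset_closure (X \ {w}) (Set.sdiff_subset.trans hX) ⟨hx, hxw⟩
  have h2 := M.eRk_mono h1
  rw [M.eRk_closure_eq, ← coe_mpRk M X, ← coe_mpRk M (X \ {w})] at h2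
  exact_mod_cast h2

/-- If `w ∈ X` does not lie in the closure of `X ∖ {w}` (`w` is a coloop of `M ↾ X`), removing it drops the rank
by exactly one. -/
lemma mpRk_sdiff_singleton_add_one {X : Set α} {w : α} (hwX : w ∈ X) (hwE : w ∈ M.E)
    (hw : w ∉ M.closure (X \ {w})) : mpRk M (X \ {w}) + 1 = mpRk M X := by
  have h := M.eRk_insert_eq_add_one (e := w) (X := X \ {w}) ⟨hwE, hw⟩
  rw [Set.insert_sdiff_self_of_mem hwX, ← coe_mpRk M X, ← coe_mpRk M (X \ {w})] at h
  exact_mod_cast h.symm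

/-! ## The equal-rank slice (M₀) and the induction -/

omit [M.Finite] in
/-- **(M₀), the equal-rank slice of the cumulative skew** (a `Prop`, NOT asserted): for every pair of disjoint
independent `Y₁, Y₂ ⊆ E` whose complementary minors have EQUAL rank (`r(E ∖ Y₂) + #Y₂ = r(E ∖ Y₁) + #Y₁`),
`p_i(Y₁,Y₂) ≤ p_j(Y₁,Y₂)` for all `i < j` with `i + j ≤ m − 1`. -/
def MinorPairEqualRankSkew : Prop :=
  ∀ Y₁ Y₂ : Set α, Y₁ ⊆ M.E → Y₂ ⊆ M.E → Disjoint Y₁ Y₂ → M.Indep Y₁ → M.Indep Y₂ →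
    mpRk M (M.E \ Y₂) + Y₂.ncard = mpRk M (M.E \ Y₁) + Y₁.ncard →
    MinorPairSkew M Y₁ Y₂ ((M.E \ (Y₁ ∪ Y₂)).ncard - 1)

/-- A pair with a dependent first set has a zero profile. -/
lemma minorPairCount_eq_zero_of_not_indep_left {Y₁ Y₂ : Set α} (h : ¬ M.Indep Y₁) (i : ℕ) :
    minorPairCount M Y₁ Y₂ i = 0 := by
  unfold minorPairCount
  rw [Set.ncard_eq_zero (minorPairSets_finite M Y₁ Y₂ i)]
  ext S
  simp only [minorPairSets, Set.mem_setOf_eq, Set.mem_empty_iff_false, iff_false, not_and]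
  intro _ _ hind _
  exact h (hind.subset Set.subset_union_right)

/-- A pair with a dependent second set has a zero profile. -/
lemma minorPairCount_eq_zero_of_not_indep_right {Y₁ Y₂ : Set α} (h : ¬ M.Indep Y₂) (i : ℕ) :
    minorPairCount M Y₁ Y₂ i = 0 := by
  unfold minorPairCount
  rw [Set.ncard_eq_zero (minorPairSets_finite M Y₁ Y₂ i)]
  ext S
  simp only [minorPairSets, Set.mem_setOf_eq, Set.mem_empty_iff_false, iff_false, not_and]
  intro _ _ _ hind
  exact h (hind.subset Set.subset_union_right)

omit [M.Finite] in
/-- A zero profile is skewed with every parameter. -/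
lemma minorPairSkew_of_forall_eq_zero {Y₁ Y₂ : Set α} (h : ∀ i, minorPairCount M Y₁ Y₂ i = 0) (R : ℕ) :
    MinorPairSkew M Y₁ Y₂ R :=
  fun i j _ _ => by rw [h i, h j]

/-- **A non-coloop exists**: if `d ≥ 1`, some `w ∈ E ∖ (Y₁ ∪ Y₂)` lies in `cl((E ∖ Y₂) ∖ {w})`. (If every such `w`
were a coloop of `M ↾ (E ∖ Y₂)`, then `E ∖ Y₂ = Y₁ ∪ (E ∖ (Y₁ ∪ Y₂))` would be independent, so
`r(E ∖ Y₂) = #Y₁ + m`, and the rank identity would force `d = 0`.) -/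
lemma exists_mem_closure_of_pos {Y₁ Y₂ : Set α} (hY₁ : Y₁ ⊆ M.E) (hY₂ : Y₂ ⊆ M.E) (hdisj : Disjoint Y₁ Y₂)
    (hI₁ : M.Indep Y₁) {d : ℕ} (hd : 0 < d)
    (hrk : mpRk M (M.E \ Y₂) + Y₂.ncard + d = mpRk M (M.E \ Y₁) + Y₁.ncard) :
    ∃ w ∈ M.E \ (Y₁ ∪ Y₂), w ∈ M.closure ((M.E \ Y₂) \ {w}) := by
  by_contra hcon
  push Not at hcon
  -- every element of `E ∖ (Y₁ ∪ Y₂)` is a coloop of the restriction to `E ∖ Y₂`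
  have hR : M.E \ Y₂ ⊆ M.E := Set.sdiff_subset
  have hcol : M.E \ (Y₁ ∪ Y₂) ⊆ (M ↾ (M.E \ Y₂)).coloops := by
    intro w hw
    rw [← Matroid.isColoop_iff_mem_coloops, Matroid.restrict_isColoop_iff hR]
    refine ⟨hcon w hw, hw.1, fun h => hw.2 (Or.inr h)⟩
  have hY₁R : Y₁ ⊆ M.E \ Y₂ := fun x hx => ⟨hY₁ hx, fun h => Set.disjoint_left.mp hdisj hx h⟩
  have hunion : Y₁ ∪ (M.E \ (Y₁ ∪ Y₂)) = M.E \ Y₂ := by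
    ext x
    simp only [Set.mem_union, Set.mem_sdiff, not_or]
    constructor
    · rintro (hx | ⟨hxE, -, hx2⟩)
      · exact hY₁R hx
      · exact ⟨hxE, hx2⟩
    · rintro ⟨hxE, hx2⟩
      by_cases hx1 : x ∈ Y₁
      · exact Or.inl hx1
      · exact Or.inr ⟨hxE, hx1, hx2⟩
  have hind : M.Indep (M.E \ Y₂) := by
    have h1 : (M ↾ (M.E \ Y₂)).Indep (Y₁ ∪ (M.E \ (Y₁ ∪ Y₂))) :=
      (Matroid.union_indep_iff_indep_of_subset_coloops hcol).mpr
        (Matroid.restrict_indep_iff.mpr ⟨hI₁, hY₁R⟩)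
    rw [hunion] at h1
    exact (Matroid.restrict_indep_iff.mp h1).1
  -- the rank identity forces `d = 0`
  have hdisj' : Disjoint Y₁ (M.E \ (Y₁ ∪ Y₂)) := by
    rw [Set.disjoint_left]
    intro x hx hx'
    exact hx'.2 (Or.inl hx)
  have hfin : (M.E \ (Y₁ ∪ Y₂)).Finite := M.ground_finite.subset Set.sdiff_subset
  have h2 : (M.E \ Y₂).ncard = Y₁.ncard + (M.E \ (Y₁ ∪ Y₂)).ncard := by
    rw [← hunion, Set.ncard_union_eq hdisj' (M.ground_finite.subset hY₁) hfin]
  have h3 : (M.E \ Y₁).ncard = Y₂.ncard + (M.E \ (Y₁ ∪ Y₂)).ncard := by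
    have hdisj'' : Disjoint Y₂ (M.E \ (Y₁ ∪ Y₂)) := by
      rw [Set.disjoint_left]
      intro x hx hx'
      exact hx'.2 (Or.inr hx)
    have hunion' : Y₂ ∪ (M.E \ (Y₁ ∪ Y₂)) = M.E \ Y₁ := by
      ext x
      simp only [Set.mem_union, Set.mem_sdiff, not_or]
      constructor
      · rintro (hx | ⟨hxE, hx1, -⟩)
        · exact ⟨hY₂ hx, fun h => Set.disjoint_left.mp hdisj h hx⟩
        · exact ⟨hxE, hx1⟩
      · rintro ⟨hxE, hx1⟩
        by_cases hx2 : x ∈ Y₂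
        · exact Or.inl hx2
        · exact Or.inr ⟨hxE, hx1, hx2⟩
    rw [← hunion', Set.ncard_union_eq hdisj'' (M.ground_finite.subset hY₂) hfin]
  have h4 := mpRk_indep M hind
  have h5 := mpRk_le_ncard M (M.ground_finite.subset (Set.sdiff_subset (s := M.E) (t := Y₁)))
  omega

omit [M.Finite] in
/-- The ground set of the through-`w` child: `E ∖ (insert w Y₁ ∪ Y₂) = (E ∖ (Y₁ ∪ Y₂)) ∖ {w}`. -/
lemma ground_sdiff_insert_left (Y₁ Y₂ : Set α) (w : α) :
    M.E \ (insert w Y₁ ∪ Y₂) = (M.E \ (Y₁ ∪ Y₂)) \ {w} := by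
  ext x
  simp only [Set.mem_sdiff, Set.mem_union, Set.mem_insert_iff, Set.mem_singleton_iff, not_or]
  tauto

omit [M.Finite] in
/-- The ground set of the avoid-`w` child: `E ∖ (Y₁ ∪ insert w Y₂) = (E ∖ (Y₁ ∪ Y₂)) ∖ {w}`. -/
lemma ground_sdiff_insert_right (Y₁ Y₂ : Set α) (w : α) :
    M.E \ (Y₁ ∪ insert w Y₂) = (M.E \ (Y₁ ∪ Y₂)) \ {w} := by
  ext x
  simp only [Set.mem_sdiff, Set.mem_union, Set.mem_insert_iff, Set.mem_singleton_iff, not_or]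
  tauto

/-- **THE INDUCTION** (dossier §41.5): from (M₀) for `M`, every pair of disjoint independent `Y₁, Y₂ ⊆ E` with
`r(E ∖ Y₂) + #Y₂ + d = r(E ∖ Y₁) + #Y₁` satisfies `MinorPairSkew M Y₁ Y₂ (m − 1 − d)`, `m = #(E ∖ (Y₁ ∪ Y₂))`. -/
theorem minorPairSkew_of_equalRankSkew (hbase : MinorPairEqualRankSkew M) :
    ∀ (m : ℕ) (Y₁ Y₂ : Set α) (d : ℕ), Y₁ ⊆ M.E → Y₂ ⊆ M.E → Disjoint Y₁ Y₂ → M.Indep Y₁ → M.Indep Y₂ →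
      (M.E \ (Y₁ ∪ Y₂)).ncard = m →
      mpRk M (M.E \ Y₂) + Y₂.ncard + d = mpRk M (M.E \ Y₁) + Y₁.ncard →
      MinorPairSkew M Y₁ Y₂ (m - 1 - d) := by
  intro m
  induction m using Nat.strong_induction_on with
  | _ m ih =>
  intro Y₁ Y₂ d hY₁ hY₂ hdisj hI₁ hI₂ hm hrk
  rcases Nat.eq_zero_or_pos d with rfl | hd
  · rw [Nat.sub_zero, ← hm]
    exact hbase Y₁ Y₂ hY₁ hY₂ hdisj hI₁ hI₂ (by simpa using hrk)
  -- a non-coloop `w` of `M ↾ (E ∖ Y₂)` outside `Y₁ ∪ Y₂`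
  obtain ⟨w, hw, hwcl⟩ := exists_mem_closure_of_pos M hY₁ hY₂ hdisj hI₁ hd hrk
  have hwE : w ∈ M.E := hw.1
  have hwY : w ∉ Y₁ ∪ Y₂ := hw.2
  have hwY₁ : w ∉ Y₁ := fun h => hwY (Or.inl h)
  have hwY₂ : w ∉ Y₂ := fun h => hwY (Or.inr h)
  have hfin : (M.E \ (Y₁ ∪ Y₂)).Finite := M.ground_finite.subset Set.sdiff_subset
  have hm1 : ((M.E \ (Y₁ ∪ Y₂)) \ {w}).ncard = m - 1 := by
    rw [Set.ncard_sdiff_singleton_of_mem hw, hm]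
  have hmpos : 1 ≤ m := by
    rw [← hm]; exact (Set.ncard_pos hfin).mpr ⟨w, hw⟩
  have hwR : w ∈ M.E \ Y₂ := ⟨hwE, hwY₂⟩
  have hY₁fin : Y₁.Finite := M.ground_finite.subset hY₁
  have hY₂fin : Y₂.Finite := M.ground_finite.subset hY₂
  apply minorPairSkew_of_split M hw
  -- the through-`w` child `(insert w Y₁, Y₂)`
  · by_cases hI₁' : M.Indep (insert w Y₁)
    · -- its rank identity: `d₁ ∈ {d, d + 1}`
      have hE1 : M.E \ insert w Y₁ = (M.E \ Y₁) \ {w} := by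
        ext x
        simp only [Set.mem_sdiff, Set.mem_insert_iff, Set.mem_singleton_iff, not_or]
        tauto
      have hins : mpRk M ((M.E \ Y₁) \ {w}) + 1 ≥ mpRk M (M.E \ Y₁) := by
        have h := mpRk_insert_le M w ((M.E \ Y₁) \ {w})
        have hwX : w ∈ M.E \ Y₁ := ⟨hwE, hwY₁⟩
        rw [Set.insert_sdiff_self_of_mem hwX] at h
        exact h
      have hmono : mpRk M ((M.E \ Y₁) \ {w}) ≤ mpRk M (M.E \ Y₁) := mpRk_mono M Set.sdiff_subset
      have hcard : (insert w Y₁).ncard = Y₁.ncard + 1 := Set.ncard_insert_of_notMem hwY₁ hY₁fin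
      obtain ⟨d₁, hd₁⟩ : ∃ d₁ : ℕ,
          mpRk M (M.E \ Y₂) + Y₂.ncard + d₁ = mpRk M (M.E \ insert w Y₁) + (insert w Y₁).ncard := by
        refine ⟨mpRk M (M.E \ insert w Y₁) + (insert w Y₁).ncard - (mpRk M (M.E \ Y₂) + Y₂.ncard), ?_⟩
        rw [hE1, hcard]
        omega
      have hd₁le : d₁ ≤ d + 1 := by rw [hE1, hcard] at hd₁; omega
      have hdisj₁ : Disjoint (insert w Y₁) Y₂ := by
        rw [Set.disjoint_left]
        intro x hx hx'
        rcases Set.mem_insert_iff.mp hx with rfl | hx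
        · exact hwY₂ hx'
        · exact Set.disjoint_left.mp hdisj hx hx'
      have hchild := ih (m - 1) (by omega) (insert w Y₁) Y₂ d₁ (Set.insert_subset hwE hY₁) hY₂ hdisj₁ hI₁' hI₂
        (by rw [ground_sdiff_insert_left, hm1]) hd₁
      exact minorPairSkew_mono M hchild (by omega)
    · exact minorPairSkew_of_forall_eq_zero M (minorPairCount_eq_zero_of_not_indep_left M hI₁') _
  -- the avoid-`w` child `(Y₁, insert w Y₂)`
  · by_cases hI₂' : M.Indep (insert w Y₂)
    · have hE2 : M.E \ insert w Y₂ = (M.E \ Y₂) \ {w} := by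
        ext x
        simp only [Set.mem_sdiff, Set.mem_insert_iff, Set.mem_singleton_iff, not_or]
        tauto
      have hrk2 : mpRk M ((M.E \ Y₂) \ {w}) = mpRk M (M.E \ Y₂) :=
        mpRk_sdiff_singleton_of_mem_closure M Set.sdiff_subset hwcl
      have hcard : (insert w Y₂).ncard = Y₂.ncard + 1 := Set.ncard_insert_of_notMem hwY₂ hY₂fin
      have hd₂ : mpRk M (M.E \ insert w Y₂) + (insert w Y₂).ncard + (d - 1) =
          mpRk M (M.E \ Y₁) + Y₁.ncard := by
        rw [hE2, hrk2, hcard]; omega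
      have hdisj₂ : Disjoint Y₁ (insert w Y₂) := by
        rw [Set.disjoint_left]
        intro x hx hx'
        rcases Set.mem_insert_iff.mp hx' with rfl | hx'
        · exact hwY₁ hx
        · exact Set.disjoint_left.mp hdisj hx hx'
      have hchild := ih (m - 1) (by omega) Y₁ (insert w Y₂) (d - 1) hY₁ (Set.insert_subset hwE hY₂) hdisj₂ hI₁ hI₂'
        (by rw [ground_sdiff_insert_right, hm1]) hd₂
      exact minorPairSkew_mono M hchild (by omega)
    · exact minorPairSkew_of_forall_eq_zero M (minorPairCount_eq_zero_of_not_indep_right M hI₂') _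

/-! ## (CX*) and the ladder from (M₀) -/

/-- **(CX*) FROM (M₀)**: `MinorPairEqualRankSkew M → BiContainSkew M`. For an independent `X ⊆ E` the slice
`(X, ∅)` has `r(E) + d = r(E ∖ X) + #X` with `d ≤ #X`, so its parameter `m − 1 − d ≥ #E − 2#X − 1`; a dependent `X`
has a zero profile. -/
theorem biContainSkew_of_equalRankSkew (hbase : MinorPairEqualRankSkew M) : BiContainSkew M := by
  apply biContainSkew_of_minorPairSkew
  intro X hX
  by_cases hI : M.Indep X
  · have hXfin : X.Finite := M.ground_finite.subset hX
    have hdisj : Disjoint X (∅ : Set α) := Set.disjoint_empty X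
    -- `r(E) ≤ r(E ∖ X) + #X`
    have hle : mpRk M (M.E \ ∅) + (∅ : Set α).ncard ≤ mpRk M (M.E \ X) + X.ncard := by
      rw [Set.sdiff_empty, Set.ncard_empty, add_zero]
      have h := M.eRk_le_eRk_add_eRk_sdiff (Set.sdiff_subset (s := M.E) (t := X))
      rw [Set.sdiff_sdiff_cancel_left hX, ← coe_mpRk M M.E, ← coe_mpRk M (M.E \ X), ← coe_mpRk M X,
        mpRk_indep M hI] at h
      exact_mod_cast h
    obtain ⟨d, hd, hdle⟩ : ∃ d : ℕ, mpRk M (M.E \ ∅) + (∅ : Set α).ncard + d = mpRk M (M.E \ X) + X.ncard ∧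
        d ≤ X.ncard := by
      refine ⟨mpRk M (M.E \ X) + X.ncard - (mpRk M (M.E \ ∅) + (∅ : Set α).ncard), by omega, ?_⟩
      have h1 : mpRk M (M.E \ X) ≤ mpRk M (M.E \ ∅) := mpRk_mono M (Set.sdiff_subset_sdiff_right (Set.empty_subset X))
      omega
    have h := minorPairSkew_of_equalRankSkew M hbase _ X ∅ d hX (Set.empty_subset _) hdisj hI M.empty_indep
      rfl hd
    refine minorPairSkew_mono M h ?_
    have h2 : (M.E \ (X ∪ ∅)).ncard = M.E.ncard - X.ncard := by
      rw [Set.union_empty, Set.ncard_sdiff' hX M.ground_finite]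
    rw [h2]
    omega
  · exact minorPairSkew_of_forall_eq_zero M (minorPairCount_eq_zero_of_not_indep_left M hI) _

/-- **(★★) FROM (M₀) ON THE MINORS**: `(∀ N ≤m M, MinorPairEqualRankSkew N) → BiIndepPerElem M`. -/
theorem biIndepPerElem_of_equalRankSkew (h : ∀ N : Matroid α, N ≤m M → MinorPairEqualRankSkew N) :
    BiIndepPerElem M :=
  biIndepPerElem_of_biContainSkew M (fun N hN =>
    haveI : N.Finite := ⟨M.ground_finite.subset hN.subset⟩
    biContainSkew_of_equalRankSkew N (h N hN))

end PercRepro
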